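import Summits.BirchSwinnertonDyer.BirchSwinnertonDyer.Theorems.PrintCFramBottomClassIndexLawFiveLeHerbrandStickelbergerBernoulliSum
import Summits.BirchSwinnertonDyer.BirchSwinnertonDyer.Theorems.PrintCFramBottomClassIndexLawFiveLeHerbrandStickelbergerNormPushdown
import Summits.BirchSwinnertonDyer.BirchSwinnertonDyer.Theorems.PrintCFramBottomClassIndexLawFiveLeHerbrandStickelbergerEigenAlgebra
import Summits.BirchSwinnertonDyer.BirchSwinnertonDyer.Theorems.PrintCFramBottomClassIndexLawFiveLeHerbrandStickelbergerNormCokernel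
import Mathlib.NumberTheory.NumberField.Cyclotomic.Galois
import HarnessLib

/-!
# Herbrand's direction via Stickelberger, part E₁: the theorem at the level of a subfield `E ⊆ ℚ(μ_f)`

Crux `stmt-BirchSwinnertonDyer-20372` (`PrintCFram.BottomClassIndexLawFiveLe`), line `eisenstein-resource-bdp-line`; assembly of
parts A–D (`…HerbrandStickelberger{BernoulliSum,NormPushdown,EigenAlgebra,NormCokernel}.lean`). THEOREM ONLY, unconditional:

* **`eq_zero_of_eigen_of_cyclotomic`** — `p` odd; `χ` a PRIMITIVE Dirichlet character of conductor `f`, `χ ≠ 1`, with values in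
  `ℚ_p`, not the Teichmüller character (tree reading), `‖B_{1,χ⁻¹}‖_p = 1`; `E ⊆ M = ℚ(μ_f)` number fields, `E/ℚ` Galois;
  `ψ : Gal(E/ℚ) → ℤ_pˣ` with the DICTIONARY `ψ(σ|_E) = χ(c(σ))` for all `σ ∈ Gal(M/ℚ)` (`σζ = ζ^{c(σ)}`). Then every
  `ψ`-eigenvector of `ℤ_p ⊗ Cl(𝓞 E)` is `0` — i.e. `e_ψ(ℤ_p ⊗ Cl E) = 0`: HERBRAND'S THEOREM for the abelian field `E` and the
  character `χ` (Lang Thm. 3.1 + Cor. 3 for `ℚ(μ_p)`; the general abelian case as used by Mazur–Wiles/Solomon «F1»), from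
  Stickelberger's theorem (tree) pushed down to `E` (B), read on the eigenclass (C) inside the span of the norm classes
  (C+D), with the scalar `(b − χ(b))B_{1,χ⁻¹}` a unit (A).

BSD is not proved by any of this; no summit statement is proved here.
References: [Lang1990] Ch. 1 §2 Thm. 2.3, §3 Thm. 3.1, Cor. 3; [Washington1997] §6.2–6.3 (Thm. 6.10, 6.13), Thm. 10.1;
[IrelandRosen1982] Ch. 15 §3; [Solomon1990] §I (the statement F1 for abelian fields).
-/

noncomputable section

open NumberField IsDedekindDomain TensorProduct
open scoped nonZeroDivisors
open Literature.NumberTheory.NumberFields Literature.NumberTheory.NumberFields.AmbiguousClass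
open Literature.NumberTheory.LFunctions

set_option linter.dupNamespace false
set_option autoImplicit false

namespace Summit.BirchSwinnertonDyer.BirchSwinnertonDyer.Theorems.PrintCFram.HerbrandStickelberger

variable {p : ℕ} [Fact p.Prime]

/-- **Herbrand's theorem for a subfield `E ⊆ ℚ(μ_f)` (eigenvector form).** See the module docstring.
[cite: Lang1990, Ch. 1 §3 Thm. 3.1 and Cor. 3] [cite: Washington1997, §6.3 Thm. 6.13 and §6.2 Thm. 6.10] -/
theorem eq_zero_of_eigen_of_cyclotomic (hp2 : p ≠ 2) {f : ℕ} [NeZero f] (χ : DirichletCharacter ℚ_[p] f)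
    (hχ1 : χ ≠ 1) (hprim : χ.IsPrimitive)
    (hχω : ¬ ∀ a : ℤ, ¬ ((p : ℤ) ∣ a) → ‖χ (a : ZMod f) - (a : ℚ_[p])‖ < 1)
    (hB : ‖(generalizedBernoulli 1 χ⁻¹ : ℚ_[p])‖ = 1)
    (E M : Type) [Field E] [NumberField E] [Field M] [NumberField M] [Algebra E M] [IsGalois ℚ E]
    [IsCyclotomicExtension {f} ℚ M] [IsScalarTower ℚ E M]
    (ψ : (E ≃ₐ[ℚ] E) →* ℤ_[p]ˣ)
    (hdict : ∀ σ : M ≃ₐ[ℚ] M, (((ψ (AlgEquiv.restrictNormalHom E σ)) : ℤ_[p]) : ℚ_[p]) =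
      χ ((IsCyclotomicExtension.Rat.galEquivZMod f M σ : (ZMod f)ˣ) : ZMod f))
    {y : ℤ_[p] ⊗[ℤ] Additive (ClassGroup (𝓞 E))}
    (hy : ∀ σ : E ≃ₐ[ℚ] E, pClassGroupRep ℚ E p σ y = ((ψ σ : ℤ_[p]ˣ) : ℤ_[p]) • y) : y = 0 := by
  classical
  haveI : IsAbelianGalois ℚ M := IsCyclotomicExtension.isAbelianGalois {f} ℚ M
  set c := IsCyclotomicExtension.Rat.galEquivZMod f M with hc
  -- an element `σ₀` with `ψ(σ₀) − 1` a unit: `χ(u) ≠ 1` for some unit `u`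
  obtain ⟨u, hu⟩ := MulChar.ne_one_iff.mp hχ1
  set σ₀ : E ≃ₐ[ℚ] E := AlgEquiv.restrictNormalHom E (c.symm u) with hσ₀
  have hψσ₀ : (((ψ σ₀ : ℤ_[p]ˣ) : ℤ_[p]) : ℚ_[p]) = χ (u : ZMod f) := by
    rw [hσ₀, hdict, hc, MulEquiv.apply_symm_apply]
  have hunit : IsUnit (((ψ σ₀ : ℤ_[p]ˣ) : ℤ_[p]) - 1) := by
    rw [PadicInt.isUnit_iff, PadicInt.norm_def, PadicInt.coe_sub, PadicInt.coe_one, hψσ₀]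
    have h := norm_apply_sub_apply_eq_one hp2 χ u 1 (by rwa [Units.val_one, map_one])
    rwa [Units.val_one, map_one] at h
  -- `y` lies in the span of the norm classes from `M` (parts C §5 + D)
  have hcoker := mulEquiv_mul_inv_mem_range_classGroupNorm E M σ₀
  have hspan := mem_span_of_eigen_of_isUnit (p := p) E M σ₀ hcoker (hy σ₀) hunit
  -- Stickelberger pushed down (B), read on `y` (C §2)
  obtain ⟨b, hb, hnormB⟩ := exists_isUnit_norm_sum_floor_eq hp2 χ hχ1 hprim hχω
  have hrel := sum_smul_eq_zero_of_forall_prod_pow_eq_one (p := p) E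
    (fun σ : M ≃ₐ[ℚ] M => AlgEquiv.restrictNormalHom E σ)
    (fun σ : M ≃ₐ[ℚ] M => b * ((c σ : (ZMod f)ˣ) : ZMod f).val / f)
    (Set.range (classGroupNorm E M)) (by
      rintro _ ⟨C, rfl⟩
      exact prod_mulEquiv_restrictNormal_classGroupNorm_pow_stickelberger_eq_one M E b C) ψ hspan hy
  -- the scalar is `(b − χ(b))·B_{1,χ⁻¹}`, a unit
  set S : ℤ_[p] := ∑ σ : M ≃ₐ[ℚ] M, ((b * ((c σ : (ZMod f)ˣ) : ZMod f).val / f : ℕ) : ℤ_[p]) *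
    (((ψ (AlgEquiv.restrictNormalHom E σ))⁻¹ : ℤ_[p]ˣ) : ℤ_[p]) with hS
  have hSQ : ((S : ℤ_[p]) : ℚ_[p]) =
      ∑ v : (ZMod f)ˣ, ((b * (v : ZMod f).val / f : ℕ) : ℚ_[p]) * χ⁻¹ (v : ZMod f) := by
    rw [hS, PadicInt.coe_sum]
    refine Fintype.sum_equiv c.toEquiv _ _ fun σ => ?_
    have hinv : ((((ψ (AlgEquiv.restrictNormalHom E σ))⁻¹ : ℤ_[p]ˣ) : ℤ_[p]) : ℚ_[p]) =
        ((((ψ (AlgEquiv.restrictNormalHom E σ)) : ℤ_[p]ˣ) : ℤ_[p]) : ℚ_[p])⁻¹ := by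
      symm
      apply inv_eq_of_mul_eq_one_right
      rw [← PadicInt.coe_mul, ← Units.val_mul, mul_inv_cancel, Units.val_one, PadicInt.coe_one]
    rw [PadicInt.coe_mul, PadicInt.coe_natCast, hinv, hdict σ, ← MulChar.inv_apply_eq_inv']
    rfl
  have hSunit : IsUnit S := by
    rw [PadicInt.isUnit_iff, PadicInt.norm_def, hSQ, hnormB, hB]
  have hrel' : S • y = 0 := hrel
  obtain ⟨w, hw⟩ := hSunit
  rw [← hw] at hrel'
  exact (smul_eq_zero_iff_eq w).mp hrel'

end Summit.BirchSwinnertonDyer.BirchSwinnertonDyer.Theorems.PrintCFram.HerbrandStickelberger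

end
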